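import Literature.MathematicalPhysics.QuantumFieldTheory.Balaban1983to89.Beta.WoodburyFibre
import Literature.MathematicalPhysics.QuantumFieldTheory.Balaban1983to89.Beta.PoissonInterior
import Literature.Probability.LatticeModels.LatticeGreenRiemannSum
import Literature.Probability.LatticeModels.TorusFourierProofs
import Literature.Probability.LatticeModels.TorusGreenHeatKernel

/-!
# The free leg of the window certificates vs. the `ℤ^d` free leg of the tables — a DICTIONARY
# (`WoodburyFibre.GfreePerp` on a cubic fine torus IS lit1's `torusGreen / 2`) and the volume limit `→ G₀`

HONEST FRAMING (page 1 of everything in this package): discharging `BetaPertH` makes Bałaban's UV stability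
UNCONDITIONAL — a real constructive-QFT result; it is NOT the continuum limit and NOT the Clay problem.  This module
proves NOTHING about Bałaban's operators; it is kernel-checked normalisation plumbing between two lineages' objects
of the `β` sub-cell (unit `b2b-balaban-beta-an5` gen 8, journal node `BETA-an5-g8-FREELEG-DICT`; cell records
`HOME/GAPS.md` G-an5g8-2, `HOME/BETA/AN5.md` §12).

## Why

The window certificates of the an5 lineage (`Beta.WoodburyFibre` `bondInv_decomposition`/`Rperp`,
`Beta.WoodburyCovariant`, `Beta.LongitudinalWindow`) write the block propagators of [Balaban1984PropagatorsI] at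
`U = 1`, in King's `c = N²` scaling on the fine torus `Tor (fine N M)` (periods `N·M_μ`), as
  `Γ((x,μ),(x′,μ)) = GfreePerp N M 0 (x′ − x) + |T|⁻¹a⁻¹ − R`,   `|R| ≤ D/N^d` (and graded differences),
where `GfreePerp N M 0 w = |T|⁻¹ Σ_{p ≠ 0} e^{ip·w} / (N² Σ_μ (2 − 2cos p_μ))` is the massless, zero-average FREE torus Green
function.  The leg TABLES of the one-loop wall (`Beta.WindowInterface` §3, `Beta.GhostTable`, `Beta.SquareTable`:
`gFree = latticeGreen/2`) are built on the FREE GREEN FUNCTION OF `ℤ^d`, `G₀ = latticeGreen/2`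
(`Beta.PoissonInterior.G₀`, lit1's `Literature.Probability.LatticeModels.latticeGreen`).  The binder `hF` of
`Beta.ComposedRoad` compares an actual leg with a TABLE leg; so between the certificates and the binder sits the
identification of the two free objects.  This file supplies the exact dictionary and the qualitative volume limit;
it does NOT supply convergence RATES (finite-volume window matching `|G⊥_T − G₀| ≤ R/N²` etc. — cell record
G-an5g8-2, route (iii)), nor the volume limit of the massive remainders `R` (route (ii-a)).

## What is proved (zero `sorry`; `d` arbitrary unless stated; `N, m ≥ 1`)

On the CUBIC fine torus, `M = cubic d m := fun _ => m`:
* `tor_fine_cubic` — `Tor (fine N (cubic d m)) = TorusSite d (N*m)` and `chi_fine_cubic` — `chi = torusChar`: BOTH HOLD BY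
  `rfl` (the an5/King torus `Π_μ ZMod (N·M_μ)` with characters `Π_μ stdAddChar (p_μ x_μ)` and lit1's torus `(ZMod L)^d`
  with `torusChar k x = Π_i stdAddChar (k_i x_i)` are the same objects);
* `lapSym_fine_cubic` — King's symbol at `c = N²`, `m² = 0` is `2N² · ε(p_k)`, `ε = dispersion ∘ latticeMomentum`
  (`Σ(1 − cos)`, lit1), via lit1's `dispersion_latticeMomentum_eq_centred` (`valMinAbs` vs `val` representatives);
* `card_tor_fine_cubic` — `|T| = (N m)^d`;
* `sq_mul_GfreePerp_zero` — `N² · GfreePerp N (cubic d m) 0 w = ½ (Nm)^{−d} Σ_{k ≠ 0} torusChar k w / ε(p_k)`;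
* `re_sq_mul_GfreePerp_zero` — **`Re (N² · GfreePerp N (cubic d m) 0 w) = torusGreen w / 2`** (lit1's zero-mode-removed
  torus Green function, `LatticeGreenFunction.torusGreen`);
* `torusFreeLeg_limit` (`d ≥ 3`) — THE VOLUME LIMIT OF THE FREE PART OF THE LEGS: for every `z ∈ ℤ^d`, `a > 0`,
  `ε > 0` there is `L₀` such that for all `N, m ≥ 1` with `N·m` EVEN and `≥ L₀`,
  `|Re (N² · GfreePerp N (cubic d m) 0 (z mod Nm)) + N²/(a|T|) − G₀ z| ≤ ε`.
  Its analytic content is lit1's KERNEL theorem `LatticeGreenRiemannSum.torusGreen_tendsto_latticeGreen` (the Riemann-sum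
  convergence behind eq. (3.15) of [cite: AizenmanDuminilCopinSidoraviciusCMP2015, §3.3, arXiv v3 eq. (3.15)], proved
  there along even periods), used BY NAME; the constant `N²/(a|T|) ≤ 1/(a·Nm)` is elementary.

## Where this sits (not asserted as mathematics of the papers)

[Balaban1987RG1] (B12) p. 264, after (1.21), read as image by this seat on the render
`1987-cmp109-rg-I-small-field-p016-x2.png`: «Now we take a limit of these functions as T^{(j+1)} ↗ Z^d. This limit
exists by the localized representation (1.7). The function β_{j+1}(g_j) is defined by» (1.22).  So the `β`-function is
an infinite-volume object; along that limit the free part of the an5 legs converges to the table's `G₀`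
(`torusFreeLeg_limit`), and the volume-uniform window bounds of the certificates pass to the limit unchanged — this is
route (ii) of cell record G-an5g8-2; the limit of the massive parts (route (ii-a)) and the finite-volume rates (route
(iii)) are NOT treated here.  Nothing in this file is a hypothesis minted by the programme: the inputs are definitions
and lit1's kernel-checked theorems.
-/

noncomputable section

open Finset
open scoped BigOperators ComplexConjugate

namespace Literature.MathematicalPhysics.QuantumFieldTheory.Balaban1983to89.Beta.FreeLegDictionary

open Literature.MathematicalPhysics.QuantumFieldTheory.King1986.Torus (lapSym)
open Literature.MathematicalPhysics.QuantumFieldTheory.Balaban1983to89.B5Prop11Plancherel (Tor fine chi sOf)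
open Literature.MathematicalPhysics.QuantumFieldTheory.Balaban1983to89.Beta.WoodburyFibre (GfreePerp)
open Literature.MathematicalPhysics.QuantumFieldTheory.Balaban1983to89.Beta.PoissonInterior (G₀)
open Literature.Probability.LatticeModels (TorusSite torusChar torusGreen latticeGreen latticeMomentum dispersion
  torusChar_re dispersion_latticeMomentum_eq_centred torusGreen_tendsto_latticeGreen)

variable {d : ℕ}

/-- the cubic period vector `M_μ ≡ m` (B12 p. 251: `L_μ = L^m` for all `μ`). [folklore] -/
abbrev cubic (d m : ℕ) : Fin d → ℕ := fun _ => m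

section Dictionary

variable (N m : ℕ) [NeZero N] [NeZero m]

/-- `N·m ≠ 0`. [folklore] -/
theorem mul_period_ne_zero : N * m ≠ 0 := mul_ne_zero (NeZero.ne N) (NeZero.ne m)

omit [NeZero N] [NeZero m] in
/-- DICTIONARY (types): the cubic fine torus of the an5/King modules IS lit1's torus `(ZMod (N m))^d`, definitionally.
[folklore] -/
theorem tor_fine_cubic : Tor (fine N (cubic d m)) = TorusSite d (N * m) := rfl

/-- DICTIONARY (characters): `chi = torusChar`, definitionally (both are `Π_μ stdAddChar (p_μ x_μ)`). [folklore] -/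
theorem chi_fine_cubic (p w : Tor (fine N (cubic d m))) :
    chi (fine N (cubic d m)) p w = torusChar (L := N * m) p w := rfl

/-- DICTIONARY (symbols): King's `σ(p) = m² + c Σ_μ (2 − 2cos p′_μ)` at `c = N²`, `m² = 0` is `2N² ε(p_k)` with lit1's
dispersion `ε = Σ(1 − cos)` of the lattice momentum `2πk/L` (`valMinAbs` and `val` representatives give the same cosines).
[folklore] -/
theorem lapSym_fine_cubic (p : Tor (fine N (cubic d m))) :
    lapSym (fine N (cubic d m)) ((N : ℝ) ^ 2) 0 p = 2 * (N : ℝ) ^ 2 * dispersion (latticeMomentum (N * m) p) := by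
  rw [dispersion_latticeMomentum_eq_centred]
  simp only [lapSym, dispersion, sOf, zero_add, Finset.mul_sum]
  refine Finset.sum_congr rfl fun μ _ => ?_
  have h : ((fine N (cubic d m) μ : ℕ) : ℝ) = ((N * m : ℕ) : ℝ) := rfl
  rw [h]
  ring

/-- `|T| = (N m)^d`. [folklore] -/
theorem card_tor_fine_cubic : Fintype.card (Tor (fine N (cubic d m))) = (N * m) ^ d := by
  simp [Fintype.card_pi, ZMod.card, fine, cubic, Finset.prod_const, Finset.card_univ]

/-- DICTIONARY (Green functions, complex form):
`N² · GfreePerp N (cubic d m) 0 w = ½ (N m)^{−d} Σ_{k ≠ 0} torusChar k w / ε(p_k)`. [folklore] -/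
theorem sq_mul_GfreePerp_zero (w : Tor (fine N (cubic d m))) :
    (N : ℂ) ^ 2 * GfreePerp N (cubic d m) 0 w =
      (1 / 2 : ℂ) * ((((N * m : ℕ) : ℂ)) ^ d)⁻¹ *
        ∑ p ∈ (univ : Finset (Tor (fine N (cubic d m)))).erase 0,
          torusChar (L := N * m) p w / (dispersion (latticeMomentum (N * m) p) : ℂ) := by
  have hN : (N : ℂ) ≠ 0 := by exact_mod_cast NeZero.ne N
  have hN2 : (N : ℂ) ^ 2 ≠ 0 := pow_ne_zero 2 hN
  have hterm : ∀ p : Tor (fine N (cubic d m)),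
      chi (fine N (cubic d m)) p w / (lapSym (fine N (cubic d m)) ((N : ℝ) ^ 2) 0 p : ℂ) =
        ((N : ℂ) ^ 2)⁻¹ * ((1 / 2 : ℂ) *
          (torusChar (L := N * m) p w / (dispersion (latticeMomentum (N * m) p) : ℂ))) := by
    intro p
    rw [lapSym_fine_cubic, chi_fine_cubic]
    push_cast
    rw [div_eq_mul_inv, div_eq_mul_inv, mul_inv, mul_inv]
    ring
  unfold GfreePerp
  rw [Finset.sum_congr rfl fun p _ => hterm p, ← Finset.mul_sum, ← Finset.mul_sum, card_tor_fine_cubic]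
  push_cast
  rw [← mul_assoc, ← mul_assoc, ← mul_assoc]
  congr 1
  field_simp

/-- DICTIONARY (Green functions, THE IDENTIFICATION): the real part of `N² · GfreePerp N (cubic d m) 0 w` is HALF of lit1's
zero-mode-removed torus Green function `torusGreen w = L^{−d} Σ_{k ≠ 0} cos(p_k·w)/ε(p_k)`, `L = N m`. [folklore] -/
theorem re_sq_mul_GfreePerp_zero (w : Tor (fine N (cubic d m))) :
    ((N : ℂ) ^ 2 * GfreePerp N (cubic d m) 0 w).re = torusGreen (L := N * m) w / 2 := by
  rw [sq_mul_GfreePerp_zero]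
  have hcast : (1 / 2 : ℂ) * ((((N * m : ℕ) : ℂ)) ^ d)⁻¹ = (((1 / 2 : ℝ) * ((((N * m : ℕ) : ℝ)) ^ d)⁻¹ : ℝ) : ℂ) := by
    push_cast; ring
  rw [hcast, Complex.re_ofReal_mul, Complex.re_sum]
  have hre : ∀ p : Tor (fine N (cubic d m)),
      (torusChar (L := N * m) p w / (dispersion (latticeMomentum (N * m) p) : ℂ)).re =
        Real.cos (∑ i, latticeMomentum (N * m) p i * (((w i).val : ℕ) : ℝ)) /
          dispersion (latticeMomentum (N * m) p) := by
    intro p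
    rw [Complex.div_ofReal_re, torusChar_re]
  rw [Finset.sum_congr rfl fun p _ => hre p]
  unfold torusGreen
  ring

end Dictionary

section Limit

variable (N m : ℕ) [NeZero N] [NeZero m]

/-- the FREE PART of an an5 leg in the volume-limit normalisation: `Re (N² · GfreePerp 0) + N²/(a|T|)` read at the
residue of `z ∈ ℤ^d` (the two `U = 1` free terms of `WoodburyFibre.bondInv_decomposition`, times King's `N²`). [folklore] -/
def torusFreeLeg (a : ℝ) (z : Fin d → ℤ) : ℝ :=
  ((N : ℂ) ^ 2 * GfreePerp N (cubic d m) 0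
      (Literature.Probability.LatticeModels.Torus.proj (N * m) z : Tor (fine N (cubic d m)))).re +
    (N : ℝ) ^ 2 / (a * (Fintype.card (Tor (fine N (cubic d m))) : ℝ))

/-- the free part is `torusGreen/2 + N²/(a (Nm)^d)`. [folklore] -/
theorem torusFreeLeg_eq (a : ℝ) (z : Fin d → ℤ) :
    torusFreeLeg N m a z =
      torusGreen (Literature.Probability.LatticeModels.Torus.proj (N * m) z) / 2 +
        (N : ℝ) ^ 2 / (a * ((N * m : ℕ) : ℝ) ^ d) := by
  unfold torusFreeLeg
  rw [re_sq_mul_GfreePerp_zero, card_tor_fine_cubic]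
  push_cast
  ring

/-- the zero-mode constant is small: `N²/(a (Nm)^d) ≤ 1/(a · N m)` for `d ≥ 3`, `a > 0`. [folklore] -/
theorem zeroMode_const_le {a : ℝ} (ha : 0 < a) (hd : 3 ≤ d) :
    (N : ℝ) ^ 2 / (a * ((N * m : ℕ) : ℝ) ^ d) ≤ 1 / (a * ((N * m : ℕ) : ℝ)) := by
  have hN1 : (1 : ℝ) ≤ N := by exact_mod_cast Nat.one_le_iff_ne_zero.mpr (NeZero.ne N)
  have hm1 : (1 : ℝ) ≤ m := by exact_mod_cast Nat.one_le_iff_ne_zero.mpr (NeZero.ne m)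
  have hL1 : (1 : ℝ) ≤ ((N * m : ℕ) : ℝ) := by push_cast; nlinarith
  have hL0 : (0 : ℝ) < ((N * m : ℕ) : ℝ) := by linarith
  rw [div_le_div_iff₀ (by positivity) (by positivity)]
  -- N² · (a L) ≤ 1 · (a L^d): N² ≤ L² ≤ L^{d-1}
  have hNL : (N : ℝ) ≤ ((N * m : ℕ) : ℝ) := by push_cast; nlinarith
  have h2 : (N : ℝ) ^ 2 ≤ ((N * m : ℕ) : ℝ) ^ 2 := by gcongr
  have h3 : ((N * m : ℕ) : ℝ) ^ 2 ≤ ((N * m : ℕ) : ℝ) ^ (d - 1) := pow_le_pow_right₀ hL1 (by omega)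
  calc (N : ℝ) ^ 2 * (a * ((N * m : ℕ) : ℝ)) ≤ ((N * m : ℕ) : ℝ) ^ (d - 1) * (a * ((N * m : ℕ) : ℝ)) := by
        gcongr; exact h2.trans h3
    _ = 1 * (a * ((N * m : ℕ) : ℝ) ^ d) := by
        have : ((N * m : ℕ) : ℝ) ^ d = ((N * m : ℕ) : ℝ) ^ (d - 1) * ((N * m : ℕ) : ℝ) := by
          rw [← pow_succ]; congr 1; omega
        rw [this]; ring

end Limit

/-- **THE VOLUME LIMIT OF THE FREE PART OF THE LEGS** (`d ≥ 3`): along cubic fine tori with EVEN period `N m → ∞`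
the free part `Re (N² GfreePerp 0) + N²/(a|T|)` of the an5 window decompositions converges, at every fixed `z ∈ ℤ^d`,
to the tables' free leg `G₀ z = latticeGreen z / 2`.  Analytic content: lit1's kernel theorem
`torusGreen_tendsto_latticeGreen` (Riemann-sum convergence, ADS15 (3.15)); here only the dictionary and the zero-mode
constant are added. [cite: AizenmanDuminilCopinSidoraviciusCMP2015, §3.3, arXiv v3 eq. (3.15)] -/
theorem torusFreeLeg_limit (hd : 3 ≤ d) {a : ℝ} (ha : 0 < a) (z : Fin d → ℤ) {ε : ℝ} (hε : 0 < ε) :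
    ∃ L₀ : ℕ, ∀ (N m : ℕ) [NeZero N] [NeZero m], Even (N * m) → L₀ ≤ N * m →
      |torusFreeLeg N m a z - G₀ z| ≤ ε := by
  obtain ⟨L₁, hL₁⟩ := torusGreen_tendsto_latticeGreen (d := d) hd z hε
  refine ⟨max L₁ (Nat.ceil (2 / (a * ε))), fun N m _ _ heven hle => ?_⟩
  haveI : NeZero (N * m) := ⟨mul_period_ne_zero N m⟩
  have hG := hL₁ (N * m) heven (le_trans (le_max_left _ _) hle)
  have hceil : (Nat.ceil (2 / (a * ε)) : ℝ) ≤ ((N * m : ℕ) : ℝ) := by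
    exact_mod_cast le_trans (le_max_right _ _) hle
  have hL0 : (0 : ℝ) < ((N * m : ℕ) : ℝ) := by exact_mod_cast Nat.pos_of_ne_zero (mul_period_ne_zero N m)
  have hconst : (N : ℝ) ^ 2 / (a * ((N * m : ℕ) : ℝ) ^ d) ≤ ε / 2 := by
    refine (zeroMode_const_le N m ha hd).trans ?_
    have h2 : 2 / (a * ε) ≤ ((N * m : ℕ) : ℝ) := (Nat.le_ceil _).trans hceil
    rw [div_le_div_iff₀ (by positivity) (by norm_num)]
    rw [div_le_iff₀ (by positivity)] at h2
    linarith
  have hconst0 : 0 ≤ (N : ℝ) ^ 2 / (a * ((N * m : ℕ) : ℝ) ^ d) := by positivity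
  rw [torusFreeLeg_eq]
  unfold G₀
  have : torusGreen (Literature.Probability.LatticeModels.Torus.proj (N * m) z) / 2 +
        (N : ℝ) ^ 2 / (a * ((N * m : ℕ) : ℝ) ^ d) - latticeGreen z / 2 =
      (torusGreen (Literature.Probability.LatticeModels.Torus.proj (N * m) z) - latticeGreen z) / 2 +
        (N : ℝ) ^ 2 / (a * ((N * m : ℕ) : ℝ) ^ d) := by ring
  rw [this]
  calc |(torusGreen (Literature.Probability.LatticeModels.Torus.proj (N * m) z) - latticeGreen z) / 2 +
          (N : ℝ) ^ 2 / (a * ((N * m : ℕ) : ℝ) ^ d)|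
      ≤ |(torusGreen (Literature.Probability.LatticeModels.Torus.proj (N * m) z) - latticeGreen z) / 2| +
          |(N : ℝ) ^ 2 / (a * ((N * m : ℕ) : ℝ) ^ d)| := abs_add_le _ _
    _ ≤ ε / 2 + ε / 2 := by
        gcongr
        · rw [abs_div, abs_two]; linarith
        · rw [abs_of_nonneg hconst0]; exact hconst
    _ = ε := by ring

end Literature.MathematicalPhysics.QuantumFieldTheory.Balaban1983to89.Beta.FreeLegDictionary

end
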